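import Summits.Ventures.LatticeQCDFlow.Scaling.SwapAcceptanceKernel
import Summits.Ventures.LatticeQCDFlow.Scaling.WilsonTransferAcceptanceWindow
import Summits.Ventures.LatticeQCDFlow.Exactness.PTBCSwapSignRule

/-!
HONEST FRAMING: exact (Metropolis-corrected) sampling algorithms for lattice gauge theory; figures
of merit are autocorrelation/cost numbers at stated couplings and volumes; no continuum-physics
claim.

# SwapAcceptanceMonotone — THE EXACT SWAP ACCEPTANCE OF A LINEAR TEMPERING FAMILY IS MONOTONE IN THE GAP:
# `swapAcc(s, t′) ≤ swapAcc(s, t)` FOR `s ≤ t ≤ t′`, `swapAcc(s′, t) ≤ swapAcc(s, t)` FOR `s′ ≤ s ≤ t`, HENCE A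
# NESTED PAIR ACCEPTS AT LEAST AS OFTEN — WHATEVER THE ACTION, NOT ONLY IN THE GAUSSIAN MODEL (row 22
# `su3-ptbc`, GEN-8, ours; meets row 22's sign rule `Exactness/PTBCSwapSignRule` with lean-2's
# `Scaling/SwapAcceptanceLaw`)

Venture `LatticeQCDFlow` (cell pub-lqcd), topic `Scaling`; FANOUT row 22 (`su3-ptbc`, PTBC comparator arm
E4).  NEW WORK of the cell over the tree: lean-2's bounded exponential family `μ_u = μ.tilted (u·X)` and the
swap functional `swapAcc X μ s t = ∫∫ min(1, e^{(t−s)(X x − X y)}) dμ_s(x) dμ_t(y)`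
(`Scaling/SwapAcceptanceLaw`; `swapAcc_eq_imh`, `swapAcc_le_one`, `integrable_exp_mul_of_bounded`,
`isProbabilityMeasure_tilted_mul`), its product form `μ_s ⊗ μ_t = (μ⊗μ).tilted(sX ⊕ tX)`
(`Scaling/SwapAcceptanceKernel.tilted_prod_tilted_mul`), its symmetry `Theory2.swapAcc_symm`
(`Scaling/WilsonTransferAcceptanceWindow`), and row 22's GEN-5 SIGN RULE for the swap
proposal (`Exactness/PTBCSwapSignRule.swap_acceptance_sign_rule`: `∫ min(1,e^{−ΔS}) e^{−E} = ∫ 𝟙[ΔS ≤ 0]e^{−E}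
+ ∫ 𝟙[ΔS < 0]e^{−E}`).  Mathlib: `integral_tilted`, `tilted_apply_eq_ofReal_integral'`, `Measure.prod_apply`.
Nothing is cited as a fact; no numerics.

WHY (CARD-su3-ptbc §1.6 / §3, the tuning lever).  The card's ladder is tuned by moving boundary parameters
until every adjacent pair accepts `20 ± 5 %`; the retune step (bisection on `c_{i+1}` at fixed `c_i`) and the
refinement step (insert a level inside a pair that accepts too rarely) both PRESUME that the pair acceptance
falls when the pair is pulled apart and that a nested pair accepts at least as often.  In the Gaussian swap
model this is `strictAnti_gaussAcc` (`SwapLadderLogConcave`).  Here it is proved EXACTLY, at stationarity, for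
every bounded measurable `X` and every base probability measure `μ` — i.e. for PTBC's linear defect family
(`X = −S_D`, parameter the boundary coupling; docking as in `Scaling/DefectSwapAcceptance`) with no modelling
step at all.

## What is proved (`μ` a probability measure, `X` bounded measurable, `μ_u := μ.tilted (u·X)`)

* §1 STOCHASTIC ORDER OF EXPONENTIAL TILTS: `t ≤ t′ ⇒ μ_{t′}{X ≤ c} ≤ μ_t{X ≤ c}` and `μ_{t′}{X < c} ≤ μ_t{X < c}`
  for every `c` (`tilted_apply_le_anti`, `tilted_apply_lt_anti`; elementary: on `{X ≤ c}` the extra weight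
  `e^{(t′−t)X}` is `≤ e^{(t′−t)c}`, on the complement it is `≥ e^{(t′−t)c}`).
* §2 THE INVERSION LAW in lean-2's vocabulary (row 22's sign rule transported to `swapAcc`): for `s < t`,
  **`swapAcc_eq_inversion`** — `swapAcc X μ s t = P{X₂ ≤ X₁} + P{X₂ < X₁}`, `P = μ_s ⊗ μ_t` (`X₁` the
  sample of the less tilted law, `X₂` of the more tilted one): the mean swap acceptance is the probability of
  an inversion, counted twice off the diagonal.
* §3 MONOTONICITY: **`swapAcc_anti_right`** (`s ≤ t ≤ t′ ⇒ swapAcc s t′ ≤ swapAcc s t`), `swapAcc_self`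
  (`= 1` at `t = s`), `swapAcc_neg` (`X ↦ −X`, `(s,t) ↦ (−s,−t)`), **`swapAcc_mono_left`**
  (`s′ ≤ s ≤ t ⇒ swapAcc s′ t ≤ swapAcc s t`), and **`swapAcc_nested`** (`s ≤ a ≤ b ≤ t ⇒
  swapAcc s t ≤ swapAcc a b`): refining a ladder never lowers a pair acceptance.

Literature grade (cell rule): KNOWN MECHANISM (monotone likelihood ratio ⇒ stochastic order of an exponential
family, Lehmann 1955 / Karlin–Rubin 1956; every adaptive-ladder scheme of parallel tempering presumes the
acceptance falls with the gap, e.g. Hukushima–Nemoto 1996, Katzgraber–Trebst–Huse–Troyer 2006), NEW TYPING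
(exact, measure level, every bounded linear family).  presearch (corpus hybrid + galaxy, 2026-08-25): no printed
statement of the exact monotonicity found (nearest: Berg 2004 p. 240, the exchange move itself).  NOT CLAIMED:
strict monotonicity (true iff `X` is not `μ`-a.s. constant; not needed by the card); continuity in `t`;
anything about a run.
-/

noncomputable section

open MeasureTheory ProbabilityTheory Real Set

namespace Summit.Ventures.LatticeQCDFlow.Scaling

open Summit.Ventures.LatticeQCDFlow.Exactness (pairEnergy swapDelta swap_acceptance_sign_rule)

variable {Ω : Type*} [MeasurableSpace Ω] {μ : Measure Ω} [IsProbabilityMeasure μ] {X : Ω → ℝ}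

/-! ## §1 Stochastic order of exponential tilts -/

section Tilt

/-- On `{X ≤ c}` the tilt weight grows at most by `e^{(t′−t)c}`:
`∫_{X ≤ c} e^{t′X} dμ ≤ e^{(t′−t)c} ∫_{X ≤ c} e^{tX} dμ` (`t ≤ t′`). [folklore] -/
theorem setIntegral_exp_mul_le_of_le (hXm : Measurable X) (hXb : ∃ C, ∀ ω, |X ω| ≤ C) {t t' : ℝ}
    (htt' : t ≤ t') (c : ℝ) :
    ∫ ω in {ω | X ω ≤ c}, exp (t' * X ω) ∂μ
      ≤ exp ((t' - t) * c) * ∫ ω in {ω | X ω ≤ c}, exp (t * X ω) ∂μ := by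
  rw [← integral_const_mul]
  refine setIntegral_mono_on (integrable_exp_mul_of_bounded hXm hXb t').integrableOn
    ((integrable_exp_mul_of_bounded hXm hXb t).integrableOn.const_mul _)
    (measurableSet_le hXm measurable_const) fun ω hω => ?_
  rw [← exp_add, exp_le_exp]
  have : (t' - t) * X ω ≤ (t' - t) * c := mul_le_mul_of_nonneg_left hω (sub_nonneg.2 htt')
  linarith

/-- On `{c < X}` the tilt weight grows at least by `e^{(t′−t)c}`:
`e^{(t′−t)c} ∫_{c < X} e^{tX} dμ ≤ ∫_{c < X} e^{t′X} dμ` (`t ≤ t′`). [folklore] -/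
theorem mul_setIntegral_exp_mul_le_of_le (hXm : Measurable X) (hXb : ∃ C, ∀ ω, |X ω| ≤ C) {t t' : ℝ}
    (htt' : t ≤ t') (c : ℝ) :
    exp ((t' - t) * c) * ∫ ω in {ω | X ω ≤ c}ᶜ, exp (t * X ω) ∂μ
      ≤ ∫ ω in {ω | X ω ≤ c}ᶜ, exp (t' * X ω) ∂μ := by
  rw [← integral_const_mul]
  refine setIntegral_mono_on ((integrable_exp_mul_of_bounded hXm hXb t).integrableOn.const_mul _)
    (integrable_exp_mul_of_bounded hXm hXb t').integrableOn
    (measurableSet_le hXm measurable_const).compl fun ω hω => ?_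
  rw [mem_compl_iff, mem_setOf_eq, not_le] at hω
  rw [← exp_add, exp_le_exp]
  have : (t' - t) * c ≤ (t' - t) * X ω := mul_le_mul_of_nonneg_left hω.le (sub_nonneg.2 htt')
  linarith

/-- The same two bounds for the strict sublevel set `{X < c}` and its complement. [folklore] -/
theorem setIntegral_exp_mul_le_of_le' (hXm : Measurable X) (hXb : ∃ C, ∀ ω, |X ω| ≤ C) {t t' : ℝ}
    (htt' : t ≤ t') (c : ℝ) :
    ∫ ω in {ω | X ω < c}, exp (t' * X ω) ∂μ
        ≤ exp ((t' - t) * c) * ∫ ω in {ω | X ω < c}, exp (t * X ω) ∂μ ∧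
      exp ((t' - t) * c) * ∫ ω in {ω | X ω < c}ᶜ, exp (t * X ω) ∂μ
        ≤ ∫ ω in {ω | X ω < c}ᶜ, exp (t' * X ω) ∂μ := by
  constructor
  · rw [← integral_const_mul]
    refine setIntegral_mono_on (integrable_exp_mul_of_bounded hXm hXb t').integrableOn
      ((integrable_exp_mul_of_bounded hXm hXb t).integrableOn.const_mul _)
      (measurableSet_lt hXm measurable_const) fun ω hω => ?_
    rw [← exp_add, exp_le_exp]
    have : (t' - t) * X ω ≤ (t' - t) * c := mul_le_mul_of_nonneg_left (le_of_lt hω) (sub_nonneg.2 htt')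
    linarith
  · rw [← integral_const_mul]
    refine setIntegral_mono_on ((integrable_exp_mul_of_bounded hXm hXb t).integrableOn.const_mul _)
      (integrable_exp_mul_of_bounded hXm hXb t').integrableOn
      (measurableSet_lt hXm measurable_const).compl fun ω hω => ?_
    rw [mem_compl_iff, mem_setOf_eq, not_lt] at hω
    rw [← exp_add, exp_le_exp]
    have : (t' - t) * c ≤ (t' - t) * X ω := mul_le_mul_of_nonneg_left hω (sub_nonneg.2 htt')
    linarith

/-- The algebra of the stochastic order: if on a measurable set `A` the `t′`-weight is at most `e^{δc}` times
the `t`-weight and on `Aᶜ` at least, then the NORMALISED `t′`-mass of `A` is at most the normalised `t`-mass.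
[folklore] -/
theorem tilted_apply_anti_of_bounds (hXm : Measurable X) (hXb : ∃ C, ∀ ω, |X ω| ≤ C) {t t' : ℝ}
    {A : Set Ω} (hA : MeasurableSet A) {k : ℝ}
    (h₁ : ∫ ω in A, exp (t' * X ω) ∂μ ≤ k * ∫ ω in A, exp (t * X ω) ∂μ)
    (h₂ : k * ∫ ω in Aᶜ, exp (t * X ω) ∂μ ≤ ∫ ω in Aᶜ, exp (t' * X ω) ∂μ) :
    (μ.tilted fun ω => t' * X ω) A ≤ (μ.tilted fun ω => t * X ω) A := by
  rw [tilted_apply_eq_ofReal_integral' _ hA, tilted_apply_eq_ofReal_integral' _ hA]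
  refine ENNReal.ofReal_le_ofReal ?_
  rw [integral_div, integral_div]
  set a := ∫ ω in A, exp (t * X ω) ∂μ with ha_def
  set a' := ∫ ω in A, exp (t' * X ω) ∂μ with ha'_def
  set b := ∫ ω in Aᶜ, exp (t * X ω) ∂μ with hb_def
  set b' := ∫ ω in Aᶜ, exp (t' * X ω) ∂μ with hb'_def
  have hZ : ∫ ω, exp (t * X ω) ∂μ = a + b :=
    (integral_add_compl hA (integrable_exp_mul_of_bounded hXm hXb t)).symm
  have hZ' : ∫ ω, exp (t' * X ω) ∂μ = a' + b' :=
    (integral_add_compl hA (integrable_exp_mul_of_bounded hXm hXb t')).symm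
  have ha : 0 ≤ a := setIntegral_nonneg hA fun ω _ => (exp_pos _).le
  have ha' : 0 ≤ a' := setIntegral_nonneg hA fun ω _ => (exp_pos _).le
  have hb : 0 ≤ b := setIntegral_nonneg hA.compl fun ω _ => (exp_pos _).le
  have hb' : 0 ≤ b' := setIntegral_nonneg hA.compl fun ω _ => (exp_pos _).le
  have hZpos : 0 < a + b := by rw [← hZ]; exact integral_exp_pos (integrable_exp_mul_of_bounded hXm hXb t)
  have hZ'pos : 0 < a' + b' := by
    rw [← hZ']; exact integral_exp_pos (integrable_exp_mul_of_bounded hXm hXb t')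
  rw [hZ, hZ', div_le_div_iff₀ hZ'pos hZpos]
  -- `a′(a + b) ≤ a(a′ + b′)` ⟸ `a′b ≤ ab′` ⟸ `a′ ≤ k a`, `k b ≤ b′`
  have key : a' * b ≤ a * b' :=
    calc a' * b ≤ k * a * b := mul_le_mul_of_nonneg_right h₁ hb
      _ = a * (k * b) := by ring
      _ ≤ a * b' := mul_le_mul_of_nonneg_left h₂ ha
  nlinarith [key]

/-- **STOCHASTIC ORDER OF EXPONENTIAL TILTS (sublevel sets)**: for `t ≤ t′` and every level `c`,
`μ_{t′}{X ≤ c} ≤ μ_t{X ≤ c}` — tilting harder towards large `X` moves mass off every sublevel set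
(monotone likelihood ratio ⇒ first-order stochastic dominance). [folklore] -/
theorem tilted_apply_le_anti (hXm : Measurable X) (hXb : ∃ C, ∀ ω, |X ω| ≤ C) {t t' : ℝ}
    (htt' : t ≤ t') (c : ℝ) :
    (μ.tilted fun ω => t' * X ω) {ω | X ω ≤ c} ≤ (μ.tilted fun ω => t * X ω) {ω | X ω ≤ c} :=
  tilted_apply_anti_of_bounds hXm hXb (measurableSet_le hXm measurable_const)
    (setIntegral_exp_mul_le_of_le hXm hXb htt' c) (mul_setIntegral_exp_mul_le_of_le hXm hXb htt' c)

/-- **STOCHASTIC ORDER OF EXPONENTIAL TILTS (strict sublevel sets)**: for `t ≤ t′` and every `c`,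
`μ_{t′}{X < c} ≤ μ_t{X < c}`. [folklore] -/
theorem tilted_apply_lt_anti (hXm : Measurable X) (hXb : ∃ C, ∀ ω, |X ω| ≤ C) {t t' : ℝ}
    (htt' : t ≤ t') (c : ℝ) :
    (μ.tilted fun ω => t' * X ω) {ω | X ω < c} ≤ (μ.tilted fun ω => t * X ω) {ω | X ω < c} :=
  tilted_apply_anti_of_bounds hXm hXb (measurableSet_lt hXm measurable_const)
    (setIntegral_exp_mul_le_of_le' hXm hXb htt' c).1 (setIntegral_exp_mul_le_of_le' hXm hXb htt' c).2

end Tilt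

/-! ## §2 The inversion law: `swapAcc = P{X₂ ≤ X₁} + P{X₂ < X₁}` -/

section Inversion

/-- Integrals against the pair law `μ_s ⊗ μ_t` are normalised weighted integrals against `μ ⊗ μ`:
`∫ g d(μ_s ⊗ μ_t) = (∫ e^{sX₁+tX₂} d(μ⊗μ))⁻¹ · ∫ g·e^{sX₁+tX₂} d(μ⊗μ)`. [folklore] -/
theorem integral_prod_tilted_eq_weighted (hXm : Measurable X) (s t : ℝ) (g : Ω × Ω → ℝ) :
    ∫ z, g z ∂((μ.tilted fun ω => s * X ω).prod (μ.tilted fun ω => t * X ω))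
      = (∫ z, exp (s * X z.1 + t * X z.2) ∂(μ.prod μ))⁻¹ *
          ∫ z, g z * exp (s * X z.1 + t * X z.2) ∂(μ.prod μ) := by
  rw [tilted_prod_tilted_mul hXm s t, integral_tilted, ← integral_const_mul]
  refine integral_congr_ae (ae_of_all _ fun z => ?_)
  simp only [smul_eq_mul]
  ring

/-- The pair-law mass of a measurable set as a normalised weighted integral of its indicator. [folklore] -/
theorem prod_tilted_real_eq_weighted (hXm : Measurable X) (s t : ℝ) {B : Set (Ω × Ω)}
    (hB : MeasurableSet B) :
    ((μ.tilted fun ω => s * X ω).prod (μ.tilted fun ω => t * X ω)).real B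
      = (∫ z, exp (s * X z.1 + t * X z.2) ∂(μ.prod μ))⁻¹ *
          ∫ z, B.indicator 1 z * exp (s * X z.1 + t * X z.2) ∂(μ.prod μ) := by
  rw [← integral_indicator_one hB, integral_prod_tilted_eq_weighted hXm s t]

/-- **THE INVERSION LAW** (row 22's sign rule in lean-2's vocabulary).  For `s < t`, with `P = μ_s ⊗ μ_t`
(first coordinate the LESS tilted replica):
`swapAcc X μ s t = P{X₂ ≤ X₁} + P{X₂ < X₁}` — the stationary mean swap acceptance is the probability that the
two samples are in inverted order, counted twice off the diagonal (`= 2P{X₂ < X₁} + P{X₂ = X₁}`).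
[ours; instance of `Exactness.swap_acceptance_sign_rule`] -/
theorem swapAcc_eq_inversion (hXm : Measurable X) (hXb : ∃ C, ∀ ω, |X ω| ≤ C) {s t : ℝ} (hst : s < t) :
    swapAcc X μ s t
      = ((μ.tilted fun ω => s * X ω).prod (μ.tilted fun ω => t * X ω)).real {z | X z.2 ≤ X z.1}
        + ((μ.tilted fun ω => s * X ω).prod (μ.tilted fun ω => t * X ω)).real {z | X z.2 < X z.1} := by
  have hB₁ : MeasurableSet {z : Ω × Ω | X z.2 ≤ X z.1} :=
    measurableSet_le (hXm.comp measurable_snd) (hXm.comp measurable_fst)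
  have hB₂ : MeasurableSet {z : Ω × Ω | X z.2 < X z.1} :=
    measurableSet_lt (hXm.comp measurable_snd) (hXm.comp measurable_fst)
  -- the two actions of the sign rule: `S₁ = −sX`, `S₂ = −tX`, reference measure `μ`
  set S₁ : Ω → ℝ := fun ω => -(s * X ω) with hS₁
  set S₂ : Ω → ℝ := fun ω => -(t * X ω) with hS₂
  have hE : ∀ z : Ω × Ω, -pairEnergy S₁ S₂ z = s * X z.1 + t * X z.2 := by
    intro z; simp only [pairEnergy, hS₁, hS₂]; ring
  have hΔ' : ∀ z : Ω × Ω, -swapDelta S₁ S₂ z = (t - s) * (X z.1 - X z.2) := by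
    intro z; simp only [swapDelta, hS₁, hS₂]; ring
  have hΔ : ∀ z : Ω × Ω, swapDelta S₁ S₂ z = (t - s) * (X z.2 - X z.1) := by
    intro z; simp only [swapDelta, hS₁, hS₂]; ring
  have hts : 0 < t - s := sub_pos.2 hst
  have hle : ∀ z : Ω × Ω, (swapDelta S₁ S₂ z ≤ 0) ↔ X z.2 ≤ X z.1 := by
    intro z
    rw [hΔ z]
    constructor
    · intro h
      by_contra h'
      rw [not_le] at h'
      exact absurd h (not_le.2 (mul_pos hts (sub_pos.2 h')))
    · intro h
      exact mul_nonpos_of_nonneg_of_nonpos hts.le (sub_nonpos.2 h)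
  have hlt : ∀ z : Ω × Ω, (swapDelta S₁ S₂ z < 0) ↔ X z.2 < X z.1 := by
    intro z
    rw [hΔ z]
    constructor
    · intro h
      by_contra h'
      rw [not_lt] at h'
      exact absurd h (not_lt.2 (mul_nonneg hts.le (sub_nonneg.2 h')))
    · intro h
      exact mul_neg_of_pos_of_neg hts (sub_neg.2 h)
  have hint : Integrable (fun z : Ω × Ω => exp (-pairEnergy S₁ S₂ z)) (μ.prod μ) := by
    have h := (integrable_exp_mul_of_bounded (μ := μ) hXm hXb s).mul_prod
      (integrable_exp_mul_of_bounded (μ := μ) hXm hXb t)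
    refine h.congr (ae_of_all _ fun z => ?_)
    show exp (s * X z.1) * exp (t * X z.2) = exp (-pairEnergy S₁ S₂ z)
    rw [hE z, exp_add]
  have hrule := swap_acceptance_sign_rule μ (S₁ := S₁) (S₂ := S₂)
    (measurable_const.mul hXm).neg (measurable_const.mul hXm).neg hint
  simp only [hΔ', hE] at hrule
  unfold swapAcc
  rw [integral_prod_tilted_eq_weighted hXm s t, prod_tilted_real_eq_weighted hXm s t hB₁,
    prod_tilted_real_eq_weighted hXm s t hB₂, ← mul_add, hrule]
  congr 2
  · refine integral_congr_ae (ae_of_all _ fun z => ?_)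
    simp only [indicator_apply, mem_setOf_eq, Pi.one_apply, hle z]
  · refine integral_congr_ae (ae_of_all _ fun z => ?_)
    simp only [indicator_apply, mem_setOf_eq, Pi.one_apply, hlt z]

end Inversion

/-! ## §3 Monotonicity in the gap -/

section Monotone

/-- Product masses compare slice by slice: if every slice of `B` over the first coordinate has `ν′`-mass at
most its `ν`-mass, then `(κ ⊗ ν′)(B) ≤ (κ ⊗ ν)(B)`. [folklore] -/
theorem prod_apply_le_of_slices {κ ν ν' : Measure Ω} [SFinite ν] [SFinite ν'] {B : Set (Ω × Ω)}
    (hB : MeasurableSet B) (h : ∀ x, ν' (Prod.mk x ⁻¹' B) ≤ ν (Prod.mk x ⁻¹' B)) :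
    (κ.prod ν') B ≤ (κ.prod ν) B := by
  rw [Measure.prod_apply hB, Measure.prod_apply hB]
  exact lintegral_mono fun x => h x

/-- `swapAcc X μ s s = 1`: equal parameters always swap. [folklore] -/
theorem swapAcc_self (hXm : Measurable X) (hXb : ∃ C, ∀ ω, |X ω| ≤ C) (s : ℝ) : swapAcc X μ s s = 1 := by
  haveI := isProbabilityMeasure_tilted_mul (μ := μ) hXm hXb s
  unfold swapAcc
  simp only [sub_self, zero_mul, exp_zero, min_self, integral_const, smul_eq_mul, mul_one, probReal_univ]

/-- **THE EXACT SWAP ACCEPTANCE FALLS WITH THE GAP (upper parameter)**: for `s ≤ t ≤ t′`,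
`swapAcc X μ s t′ ≤ swapAcc X μ s t` — for every bounded measurable `X` and every base law `μ`. [ours] -/
theorem swapAcc_anti_right (hXm : Measurable X) (hXb : ∃ C, ∀ ω, |X ω| ≤ C) {s t t' : ℝ} (hst : s ≤ t)
    (htt' : t ≤ t') : swapAcc X μ s t' ≤ swapAcc X μ s t := by
  rcases eq_or_lt_of_le hst with rfl | hst'
  · rw [swapAcc_self hXm hXb s]
    exact swapAcc_le_one hXm hXb s t'
  have hst'' : s < t' := lt_of_lt_of_le hst' htt'
  have hB₁ : MeasurableSet {z : Ω × Ω | X z.2 ≤ X z.1} :=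
    measurableSet_le (hXm.comp measurable_snd) (hXm.comp measurable_fst)
  have hB₂ : MeasurableSet {z : Ω × Ω | X z.2 < X z.1} :=
    measurableSet_lt (hXm.comp measurable_snd) (hXm.comp measurable_fst)
  rw [swapAcc_eq_inversion hXm hXb hst', swapAcc_eq_inversion hXm hXb hst'']
  refine add_le_add ?_ ?_
  · refine ENNReal.toReal_mono (measure_ne_top _ _) (prod_apply_le_of_slices hB₁ fun x => ?_)
    exact tilted_apply_le_anti hXm hXb htt' (X x)
  · refine ENNReal.toReal_mono (measure_ne_top _ _) (prod_apply_le_of_slices hB₂ fun x => ?_)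
    exact tilted_apply_lt_anti hXm hXb htt' (X x)

omit [IsProbabilityMeasure μ] in
/-- Reflection: tilting `−X` by `−u` is tilting `X` by `u`, and the swap ratio is unchanged, so
`swapAcc (−X) μ (−s) (−t) = swapAcc X μ s t`. [folklore] -/
theorem swapAcc_neg (s t : ℝ) : swapAcc (fun ω => -X ω) μ (-s) (-t) = swapAcc X μ s t := by
  unfold swapAcc
  have e : ∀ p : Ω × Ω,
      min 1 (exp ((-t - -s) * (-X p.1 - -X p.2))) = min 1 (exp ((t - s) * (X p.1 - X p.2))) := by
    intro p
    rw [show (-t - -s) * (-X p.1 - -X p.2) = (t - s) * (X p.1 - X p.2) by ring]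
  simp only [neg_mul_neg, e]

/-- **THE EXACT SWAP ACCEPTANCE FALLS WITH THE GAP (lower parameter)**: for `s′ ≤ s ≤ t`,
`swapAcc X μ s′ t ≤ swapAcc X μ s t`. [ours] -/
theorem swapAcc_mono_left (hXm : Measurable X) (hXb : ∃ C, ∀ ω, |X ω| ≤ C) {s' s t : ℝ} (hs's : s' ≤ s)
    (hst : s ≤ t) : swapAcc X μ s' t ≤ swapAcc X μ s t := by
  have hXm' : Measurable fun ω => -X ω := hXm.neg
  have hXb' : ∃ C, ∀ ω, |(fun ω => -X ω) ω| ≤ C := by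
    obtain ⟨C, hC⟩ := hXb; exact ⟨C, fun ω => by simpa only [abs_neg] using hC ω⟩
  rw [Theory2.swapAcc_symm s' t, Theory2.swapAcc_symm s t, ← swapAcc_neg t s', ← swapAcc_neg t s]
  exact swapAcc_anti_right hXm' hXb' (neg_le_neg hst) (neg_le_neg hs's)

/-- **A NESTED PAIR ACCEPTS AT LEAST AS OFTEN**: for `s ≤ a ≤ b ≤ t`, `swapAcc X μ s t ≤ swapAcc X μ a b` —
inserting levels into a ladder (refinement) never lowers an adjacent-pair acceptance, exactly. [ours] -/
theorem swapAcc_nested (hXm : Measurable X) (hXb : ∃ C, ∀ ω, |X ω| ≤ C) {s a b t : ℝ} (hsa : s ≤ a)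
    (hab : a ≤ b) (hbt : b ≤ t) : swapAcc X μ s t ≤ swapAcc X μ a b :=
  calc swapAcc X μ s t ≤ swapAcc X μ s b := swapAcc_anti_right hXm hXb (hsa.trans hab) hbt
    _ ≤ swapAcc X μ a b := swapAcc_mono_left hXm hXb hsa hab

end Monotone

end Summit.Ventures.LatticeQCDFlow.Scaling

end
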